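import Literature.NumberTheory.Automorphic.UnitaryGroupHeisenbergConjYIndependence
import Mathlib.Topology.Algebra.InfiniteSum.Constructions
import Mathlib.Topology.Algebra.InfiniteSum.ENNReal
import HarnessLib

/-!
# Rational Heisenberg coordinates `N(F) ≃ E × E⁻` and the split of the class sum of the unipotent term by the
# root coordinate `x` (Rogawski (1990), Prop. 7.3.2, pp. 96–97: `Σ_{u ∈ N(F)∖1} = Σ_{w ∈ E⁰∖0} + Σ_{x ∈ E^*} Σ_{w ∈ E⁰}`)

Topic `NumberTheory/Automorphic`; namespace `Literature.NumberTheory.Automorphic.UnitaryGroup`. THEOREMS ONLY over accepted tree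
modules (no definition, no named fact, no instance, no notation, no `sorry`). Row (E0) «RATIONAL HEISENBERG COORDINATES + SPLIT OF THE
CLASS SUM BY `heisX`» of the unipotent term `P_{z·𝒰}` (LAW 5 road of `Cruxes/H413/Lines/F0_T1InnerFormTraceIdentity.lean`, crux H413;
cell hodgecm-mathlib): the junction between ★ B1 `truncatedTraceClass_central_eq_add_mul_integral` (whose bracket sums over
`{u : rationalUnipotent F E c 3 // u ≠ 1}`) and the centre-lattice part (C) ∕ Heisenberg part (E) of Rogawski's Prop. 7.3.2.

Setting: the quasi-split `U(J₃)` of a quadratic `E/F` with involution `c` (`c * c = 1`); `N(𝔸_F) = adelicUnipotent F E c 3`,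
`N(F) = rationalUnipotent F E c 3`, the chart ★ `heisChart hc : 𝔸_E × 𝔸_E⁻ ≃ₜ N(𝔸_F)` with coordinates `coordX`, `coordY`, the lattice
`E⁻ = rationalTraceZero F E c ≤ 𝔸_E⁻ = traceZeroAdele F E c` (★ `UnitaryGroupTraceZeroLattice`), the rational elements ★ `ratHeisElt`.

* §1 `heisChart_algebraMap_mem_rationalUnipotent` (`u(ξ, w) ∈ N(F)` for `ξ ∈ E`, `w ∈ E⁻`), `heisChart_eq_one_iff` (`u(x, w) = 1 ↔ x = 0 ∧ w = 0`),
  `heisChart_injective`-type plumbing.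
* §2 **`exists_equiv_rationalUnipotent_prod`**: `N(F) ≃ E × E⁻`, `γ = u(ξ(γ), w(γ))` (★ `coordX_mem_range_of_mem`, ★
  `coordY_mem_rationalTraceZero_of_mem`, ★ `heisChart_coord`).
* §3 **`exists_equiv_sum_rationalUnipotent_ne_one`**: `(E⁻ ∖ 0) ⊕ (E^× × E⁻) ≃ N(F) ∖ 1`, `w ↦ u(0, w)`, `(ξ, w) ↦ u(ξ, w)`.
* §4 THE SPLIT of a class sum `Σ'_{u ∈ N(F)∖1} G(u)` (`G` any function of the adelic point; ★ B1's summand is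
  `G g = f(y⁻¹ (z₁ g) y)`): **`tsum_rationalUnipotent_ne_one_eq_add`** (normed complete `M`, under the summability ★ B1 carries as `hsum`):
  `Σ'_{u ≠ 1} G(u) = Σ'_{w ∈ E⁻∖0} G(u(0, w)) + Σ'_{ξ ∈ E^×} Σ'_{w ∈ E⁻} G(u(ξ, w))`, with the summability of the pieces
  (`summable_centre_of_summable_ne_one`, `summable_heis_of_summable_ne_one`, `summable_heis_fibre_of_summable_ne_one`), and the
  hypothesis-free `[0, ∞]` twin **`tsum_rationalUnipotent_ne_one_eq_add_ennreal`**. The first piece is the CENTRE LATTICE `ψᶜ`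
  (`x(u) = 0`, `u = u(0, w)`, `w ∈ E⁰ ∖ 0`), the second the Heisenberg part `ψʳ` (`x(u) = ξ ≠ 0`), whose `E⁻`-fibres are what ★ (E1a)
  `tsum_conj_heisChart_eq` ∕ `setIntegral_heisHaar_tsum_conj_heisChart_eq` consume.

## References
* J. D. Rogawski, *Automorphic Representations of Unitary Groups in Three Variables*, Ann. of Math. Stud. 123 (1990), §1.10, §7.3
  Prop. 7.3.2 (pp. 96–97) [Rogawski1990].
* J. R. Getz, H. Hahn, *An Introduction to Automorphic Representations*, GTM 300 (2024), §3.5 [GetzHahn2024].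
-/

set_option autoImplicit false

noncomputable section

open Matrix NumberField IsDedekindDomain Topology Set
open scoped MatrixGroups ENNReal NNReal

namespace Literature.NumberTheory.Automorphic

namespace UnitaryGroup

variable {F E : Type} [Field F] [NumberField F] [Field E] [NumberField E] [Algebra F E]
  {c : E ≃ₐ[F] E}

/-! ## §1 Rational chart points -/

/-- `𝔸_E` is nontrivial (local copy of the standard argument). [folklore] -/
private theorem nontrivial_adeleRing_E : Nontrivial (AdeleRing (𝓞 E) E) :=
  inferInstanceAs (Nontrivial (InfiniteAdeleRing E × FiniteAdeleRing (𝓞 E) E))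

/-- **`u(ξ, w) ∈ N(F)`** for principal `ξ ∈ E` and a lattice vector `w ∈ E⁻` (★ `ratHeisElt`). [cite: Rogawski1990, §1.10] -/
theorem heisChart_algebraMap_mem_rationalUnipotent (hc : c * c = 1) (ξ : E) (w : rationalTraceZero F E c) :
    heisChart hc (algebraMap E (AdeleRing (𝓞 E) E) ξ, (w : traceZeroAdele F E c)) ∈ rationalUnipotent F E c 3 := by
  haveI := nontrivial_adeleRing_E (E := E)
  obtain ⟨η, hη⟩ := (mem_rationalTraceZero_iff _).1 w.2
  have hηc : c η = -η := by
    have h := (mem_traceZeroAdele_iff _).1 ((w : rationalTraceZero F E c) : traceZeroAdele F E c).2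
    rw [← hη, ← algebraMap_conj, RingHom.coe_coe, ← map_neg] at h
    exact (algebraMap E (AdeleRing (𝓞 E) E)).injective h
  have hw : ((w : rationalTraceZero F E c) : traceZeroAdele F E c) =
      ⟨algebraMap E (AdeleRing (𝓞 E) E) η, algebraMap_mem_traceZeroAdele hηc⟩ := Subtype.ext hη.symm
  rw [hw]
  exact (ratHeisElt hc ξ hηc).2

/-- `u(0, w) ∈ N(F)` for a lattice vector `w ∈ E⁻` (the centre lattice). [cite: Rogawski1990, §1.10] -/
theorem heisChart_zero_coe_mem_rationalUnipotent (hc : c * c = 1) (w : rationalTraceZero F E c) :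
    heisChart hc ((0 : AdeleRing (𝓞 E) E), (w : traceZeroAdele F E c)) ∈ rationalUnipotent F E c 3 := by
  have h := heisChart_algebraMap_mem_rationalUnipotent hc (0 : E) w
  rwa [map_zero] at h

/-- **`u(x, w) = 1 ↔ x = 0 ∧ w = 0`** (★ `coordX_one`, ★ `coe_coordY_one`, ★ `heisChart_coord`). [cite: Rogawski1990, §1.10] -/
theorem heisChart_eq_one_iff (hc : c * c = 1) (x : AdeleRing (𝓞 E) E) (w : traceZeroAdele F E c) :
    heisChart hc (x, w) = 1 ↔ x = 0 ∧ w = 0 := by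
  have h1 : coordY hc (1 : adelicUnipotent F E c 3) = 0 := Subtype.ext (coe_coordY_one hc)
  constructor
  · intro h
    have hx := coordX_heisChart hc (x, w)
    have hy := coordY_heisChart hc (x, w)
    rw [h] at hx hy
    rw [coordX_one] at hx
    rw [h1] at hy
    exact ⟨hx.symm, hy.symm⟩
  · rintro ⟨rfl, rfl⟩
    have h := heisChart_coord hc (1 : adelicUnipotent F E c 3)
    rwa [coordX_one, h1] at h

/-- The chart is injective on pairs: `u(x, w) = u(x', w') → x = x' ∧ w = w'`. [cite: Rogawski1990, §1.10] -/
theorem heisChart_pair_injective (hc : c * c = 1) {x x' : AdeleRing (𝓞 E) E} {w w' : traceZeroAdele F E c}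
    (h : heisChart hc (x, w) = heisChart hc (x', w')) : x = x' ∧ w = w' := by
  have h' := (heisChart hc).injective h
  exact ⟨congrArg Prod.fst h', congrArg Prod.snd h'⟩

/-! ## §2 `N(F) ≃ E × E⁻` -/

/-- **RATIONAL HEISENBERG COORDINATES `N(F) ≃ E × E⁻`**: every `γ ∈ N(F)` is `u(ξ, w)` for a unique principal `ξ ∈ E` and lattice
vector `w ∈ E⁻` (★ `coordX_mem_range_of_mem`, ★ `coordY_mem_rationalTraceZero_of_mem`, ★ `heisChart_coord`); the equivalence `e` satisfies
`γ = u((e γ).1, (e γ).2)` and `e⁻¹(ξ, w) = u(ξ, w)`. [cite: Rogawski1990, §1.10] [cite: Rogawski1990, §7.3 (p. 97)] -/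
theorem exists_equiv_rationalUnipotent_prod (hc : c * c = 1) :
    ∃ e : rationalUnipotent F E c 3 ≃ E × rationalTraceZero F E c,
      (∀ γ : rationalUnipotent F E c 3, ((γ : rationalUnipotent F E c 3) : adelicUnipotent F E c 3) =
        heisChart hc (algebraMap E (AdeleRing (𝓞 E) E) (e γ).1, ((e γ).2 : traceZeroAdele F E c))) ∧
      ∀ (ξ : E) (w : rationalTraceZero F E c),
        ((e.symm (ξ, w) : rationalUnipotent F E c 3) : adelicUnipotent F E c 3) =
          heisChart hc (algebraMap E (AdeleRing (𝓞 E) E) ξ, (w : traceZeroAdele F E c)) := by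
  haveI := nontrivial_adeleRing_E (E := E)
  have hX : ∀ γ : rationalUnipotent F E c 3, ∃ ξ : E,
      algebraMap E (AdeleRing (𝓞 E) E) ξ = coordX ((γ : rationalUnipotent F E c 3) : adelicUnipotent F E c 3) :=
    fun γ => coordX_mem_range_of_mem γ.2
  choose ξf hξf using hX
  -- the two maps
  let toF : rationalUnipotent F E c 3 → E × rationalTraceZero F E c := fun γ =>
    (ξf γ, ⟨coordY hc ((γ : rationalUnipotent F E c 3) : adelicUnipotent F E c 3), coordY_mem_rationalTraceZero_of_mem hc γ.2⟩)
  let invF : E × rationalTraceZero F E c → rationalUnipotent F E c 3 := fun p =>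
    ⟨heisChart hc (algebraMap E (AdeleRing (𝓞 E) E) p.1, (p.2 : traceZeroAdele F E c)),
      heisChart_algebraMap_mem_rationalUnipotent hc p.1 p.2⟩
  have hinv : ∀ p, ((invF p : rationalUnipotent F E c 3) : adelicUnipotent F E c 3) =
      heisChart hc (algebraMap E (AdeleRing (𝓞 E) E) p.1, (p.2 : traceZeroAdele F E c)) := fun p => rfl
  have hto : ∀ γ, heisChart hc (algebraMap E (AdeleRing (𝓞 E) E) (toF γ).1, ((toF γ).2 : traceZeroAdele F E c)) =
      ((γ : rationalUnipotent F E c 3) : adelicUnipotent F E c 3) := by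
    intro γ
    change heisChart hc (algebraMap E (AdeleRing (𝓞 E) E) (ξf γ),
      coordY hc ((γ : rationalUnipotent F E c 3) : adelicUnipotent F E c 3)) = _
    rw [hξf γ, heisChart_coord]
  have hleft : Function.LeftInverse invF toF := fun γ => Subtype.ext (by rw [hinv, hto])
  have hright : Function.RightInverse invF toF := by
    intro p
    refine Prod.ext ?_ (Subtype.ext ?_)
    · apply (algebraMap E (AdeleRing (𝓞 E) E)).injective
      change algebraMap E (AdeleRing (𝓞 E) E) (ξf (invF p)) = _
      rw [hξf, hinv, coordX_heisChart]
    · change coordY hc ((invF p : rationalUnipotent F E c 3) : adelicUnipotent F E c 3) = (p.2 : traceZeroAdele F E c)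
      rw [hinv, coordY_heisChart]
  refine ⟨⟨toF, invF, hleft, hright⟩, fun γ => (hto γ).symm, fun ξ w => hinv (ξ, w)⟩

/-! ## §3 `(E⁻ ∖ 0) ⊕ (E^× × E⁻) ≃ N(F) ∖ 1` -/

/-- **The index set of the class sum splits by the root coordinate**: an equivalence
`Φ : {w ∈ E⁻ // w ≠ 0} ⊕ ({ξ ∈ E // ξ ≠ 0} × E⁻) ≃ {u ∈ N(F) // u ≠ 1}` with `Φ(inl w) = u(0, w)` and `Φ(inr (ξ, w)) = u(ξ, w)` (on
adelic points). [cite: Rogawski1990, §7.3 Prop. 7.3.2 (pp. 96–97)] -/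
theorem exists_equiv_sum_rationalUnipotent_ne_one (hc : c * c = 1) :
    ∃ Φ : ({w : rationalTraceZero F E c // w ≠ 0} ⊕ ({ξ : E // ξ ≠ 0} × rationalTraceZero F E c)) ≃
        {u : rationalUnipotent F E c 3 // u ≠ 1},
      (∀ w : {w : rationalTraceZero F E c // w ≠ 0},
        (((Φ (Sum.inl w)).1 : rationalUnipotent F E c 3) : adelicUnipotent F E c 3) =
          heisChart hc ((0 : AdeleRing (𝓞 E) E), ((w.1 : rationalTraceZero F E c) : traceZeroAdele F E c))) ∧
      ∀ p : {ξ : E // ξ ≠ 0} × rationalTraceZero F E c,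
        (((Φ (Sum.inr p)).1 : rationalUnipotent F E c 3) : adelicUnipotent F E c 3) =
          heisChart hc (algebraMap E (AdeleRing (𝓞 E) E) (p.1 : E), (p.2 : traceZeroAdele F E c)) := by
  haveI := nontrivial_adeleRing_E (E := E)
  obtain ⟨e, he, he'⟩ := exists_equiv_rationalUnipotent_prod (F := F) (E := E) (c := c) hc
  -- `γ = 1 ↔ e γ = (0, 0)`
  have hone : ∀ (ξ : E) (w : rationalTraceZero F E c), e.symm (ξ, w) = 1 ↔ ξ = 0 ∧ w = 0 := by
    intro ξ w
    rw [← Subtype.coe_inj, OneMemClass.coe_one, he', heisChart_eq_one_iff, map_eq_zero_iff _ (algebraMap E (AdeleRing (𝓞 E) E)).injective]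
    refine and_congr Iff.rfl ⟨fun h => Subtype.ext h, fun h => ?_⟩
    rw [h]; rfl
  -- the forward map
  let φ : ({w : rationalTraceZero F E c // w ≠ 0} ⊕ ({ξ : E // ξ ≠ 0} × rationalTraceZero F E c)) →
      {u : rationalUnipotent F E c 3 // u ≠ 1} := fun i =>
    match i with
    | Sum.inl w => ⟨e.symm (0, w.1), fun h => w.2 ((hone 0 w.1).1 h).2⟩
    | Sum.inr p => ⟨e.symm ((p.1 : E), p.2), fun h => p.1.2 ((hone _ p.2).1 h).1⟩
  have hφl : ∀ w : {w : rationalTraceZero F E c // w ≠ 0}, φ (Sum.inl w) = ⟨e.symm (0, w.1), fun h => w.2 ((hone 0 w.1).1 h).2⟩ :=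
    fun w => rfl
  have hφr : ∀ p : {ξ : E // ξ ≠ 0} × rationalTraceZero F E c,
      φ (Sum.inr p) = ⟨e.symm ((p.1 : E), p.2), fun h => p.1.2 ((hone _ p.2).1 h).1⟩ := fun p => rfl
  have hinj : Function.Injective φ := by
    rintro (w | p) (w' | p') h
    · have h2 := congrArg (fun u : {u : rationalUnipotent F E c 3 // u ≠ 1} => e u.1) h
      simp only [hφl, Equiv.apply_symm_apply, Prod.mk.injEq, true_and] at h2
      rw [Subtype.ext h2]
    · have h2 := congrArg (fun u : {u : rationalUnipotent F E c 3 // u ≠ 1} => e u.1) h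
      simp only [hφl, hφr, Equiv.apply_symm_apply, Prod.mk.injEq] at h2
      exact absurd h2.1.symm p'.1.2
    · have h2 := congrArg (fun u : {u : rationalUnipotent F E c 3 // u ≠ 1} => e u.1) h
      simp only [hφl, hφr, Equiv.apply_symm_apply, Prod.mk.injEq] at h2
      exact absurd h2.1 p.1.2
    · have h2 := congrArg (fun u : {u : rationalUnipotent F E c 3 // u ≠ 1} => e u.1) h
      simp only [hφr, Equiv.apply_symm_apply, Prod.mk.injEq] at h2
      rw [show p = p' from Prod.ext (Subtype.ext h2.1) h2.2]
  have hsurj : Function.Surjective φ := by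
    rintro ⟨u, hu⟩
    by_cases hξ : (e u).1 = 0
    · have hw : (e u).2 ≠ 0 := by
        intro hw
        apply hu
        have h := (hone (e u).1 (e u).2).2 ⟨hξ, hw⟩
        rwa [Prod.mk.eta, Equiv.symm_apply_apply] at h
      refine ⟨Sum.inl ⟨(e u).2, hw⟩, Subtype.ext ?_⟩
      rw [hφl]
      change e.symm (0, (e u).2) = u
      rw [← hξ, Prod.mk.eta, Equiv.symm_apply_apply]
    · refine ⟨Sum.inr (⟨(e u).1, hξ⟩, (e u).2), Subtype.ext ?_⟩
      rw [hφr]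
      change e.symm ((e u).1, (e u).2) = u
      rw [Prod.mk.eta, Equiv.symm_apply_apply]
  refine ⟨Equiv.ofBijective φ ⟨hinj, hsurj⟩, fun w => ?_, fun p => ?_⟩
  · rw [Equiv.ofBijective_apply, hφl]
    change ((e.symm (0, w.1) : rationalUnipotent F E c 3) : adelicUnipotent F E c 3) = _
    rw [he', map_zero]
  · rw [Equiv.ofBijective_apply, hφr]
    exact he' _ _

/-! ## §4 The split of the class sum -/

section Split

variable {M : Type*} [NormedAddCommGroup M] [CompleteSpace M]

/-- **THE SPLIT OF THE CLASS SUM BY THE ROOT COORDINATE** (Rogawski, Prop. 7.3.2: the sum over `u ∈ N(F) ∖ 1` of the unipotent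
term is the sum over the centre lattice `u(0, w)`, `w ∈ E⁰ ∖ 0`, plus the sum over `x ∈ E^*` of the sums over `w ∈ E⁰` of `u(x, w)`):
for every `G` on `G(𝔸_F)` whose class family `u ↦ G(u)` (`u ≠ 1` rational unipotent) is summable,

  `Σ'_{u ∈ N(F)∖1} G(u) = Σ'_{w ∈ E⁻∖0} G(u(0, w)) + Σ'_{ξ ∈ E^×} Σ'_{w ∈ E⁻} G(u(ξ, w))`.

[cite: Rogawski1990, §7.3 Prop. 7.3.2 (pp. 96–97)] -/
theorem tsum_rationalUnipotent_ne_one_eq_add (hc : c * c = 1) (G : (quasiSplit F E c 3).Adelic → M)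
    (hsum : Summable fun u : {u : rationalUnipotent F E c 3 // u ≠ 1} =>
      G (((u.1 : rationalUnipotent F E c 3) : adelicUnipotent F E c 3) : (quasiSplit F E c 3).Adelic)) :
    ∑' u : {u : rationalUnipotent F E c 3 // u ≠ 1},
        G (((u.1 : rationalUnipotent F E c 3) : adelicUnipotent F E c 3) : (quasiSplit F E c 3).Adelic) =
      (∑' w : {w : rationalTraceZero F E c // w ≠ 0},
          G ((heisChart hc ((0 : AdeleRing (𝓞 E) E), ((w.1 : rationalTraceZero F E c) : traceZeroAdele F E c)) :
            adelicUnipotent F E c 3) : (quasiSplit F E c 3).Adelic)) +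
        ∑' ξ : {ξ : E // ξ ≠ 0}, ∑' w : rationalTraceZero F E c,
          G ((heisChart hc (algebraMap E (AdeleRing (𝓞 E) E) (ξ.1 : E), (w : traceZeroAdele F E c)) :
            adelicUnipotent F E c 3) : (quasiSplit F E c 3).Adelic) := by
  obtain ⟨Φ, hΦl, hΦr⟩ := exists_equiv_sum_rationalUnipotent_ne_one (F := F) (E := E) (c := c) hc
  set g : {u : rationalUnipotent F E c 3 // u ≠ 1} → M := fun u =>
    G (((u.1 : rationalUnipotent F E c 3) : adelicUnipotent F E c 3) : (quasiSplit F E c 3).Adelic) with hg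
  have hΦs : Summable (g ∘ Φ) := Φ.summable_iff.2 hsum
  have h1 : Summable ((g ∘ Φ) ∘ Sum.inl) := hΦs.comp_injective Sum.inl_injective
  have h2 : Summable ((g ∘ Φ) ∘ Sum.inr) := hΦs.comp_injective Sum.inr_injective
  calc ∑' u, g u = ∑' i, (g ∘ Φ) i := (Equiv.tsum_eq Φ g).symm
    _ = (∑' w, (g ∘ Φ) (Sum.inl w)) + ∑' p, (g ∘ Φ) (Sum.inr p) := Summable.tsum_sum h1 h2
    _ = _ := by
      congr 1
      · refine tsum_congr fun w => ?_
        simp only [Function.comp_apply, hg, hΦl]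
      · have h2' : Summable (fun p : {ξ : E // ξ ≠ 0} × rationalTraceZero F E c => (g ∘ Φ) (Sum.inr p)) := h2
        rw [h2'.tsum_prod]
        refine tsum_congr fun ξ => tsum_congr fun w => ?_
        simp only [Function.comp_apply, hg, hΦr]

/-- The centre-lattice piece of a summable class family is summable. [cite: Rogawski1990, §7.3 Prop. 7.3.2 (pp. 96–97)] -/
theorem summable_centre_of_summable_ne_one (hc : c * c = 1) (G : (quasiSplit F E c 3).Adelic → M)
    (hsum : Summable fun u : {u : rationalUnipotent F E c 3 // u ≠ 1} =>
      G (((u.1 : rationalUnipotent F E c 3) : adelicUnipotent F E c 3) : (quasiSplit F E c 3).Adelic)) :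
    Summable fun w : {w : rationalTraceZero F E c // w ≠ 0} =>
      G ((heisChart hc ((0 : AdeleRing (𝓞 E) E), ((w.1 : rationalTraceZero F E c) : traceZeroAdele F E c)) :
        adelicUnipotent F E c 3) : (quasiSplit F E c 3).Adelic) := by
  obtain ⟨Φ, hΦl, -⟩ := exists_equiv_sum_rationalUnipotent_ne_one (F := F) (E := E) (c := c) hc
  have h1 := (Φ.summable_iff.2 hsum).comp_injective Sum.inl_injective
  refine h1.congr fun w => ?_
  simp only [Function.comp_apply, hΦl]

/-- The Heisenberg piece `(ξ, w) ↦ G(u(ξ, w))`, `ξ ≠ 0`, of a summable class family is summable.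
[cite: Rogawski1990, §7.3 Prop. 7.3.2 (pp. 96–97)] -/
theorem summable_heis_of_summable_ne_one (hc : c * c = 1) (G : (quasiSplit F E c 3).Adelic → M)
    (hsum : Summable fun u : {u : rationalUnipotent F E c 3 // u ≠ 1} =>
      G (((u.1 : rationalUnipotent F E c 3) : adelicUnipotent F E c 3) : (quasiSplit F E c 3).Adelic)) :
    Summable fun p : {ξ : E // ξ ≠ 0} × rationalTraceZero F E c =>
      G ((heisChart hc (algebraMap E (AdeleRing (𝓞 E) E) (p.1 : E), (p.2 : traceZeroAdele F E c)) :
        adelicUnipotent F E c 3) : (quasiSplit F E c 3).Adelic) := by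
  obtain ⟨Φ, -, hΦr⟩ := exists_equiv_sum_rationalUnipotent_ne_one (F := F) (E := E) (c := c) hc
  have h2 := (Φ.summable_iff.2 hsum).comp_injective Sum.inr_injective
  refine h2.congr fun p => ?_
  simp only [Function.comp_apply, hΦr]

/-- Each `E⁻`-fibre `w ↦ G(u(ξ, w))` (`ξ ≠ 0`) of a summable class family is summable — the summability the (E1a) lattice sums
★ `tsum_conj_heisChart_eq` run over. [cite: Rogawski1990, §7.3 Prop. 7.3.2 (pp. 96–97)] -/
theorem summable_heis_fibre_of_summable_ne_one (hc : c * c = 1) (G : (quasiSplit F E c 3).Adelic → M)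
    (hsum : Summable fun u : {u : rationalUnipotent F E c 3 // u ≠ 1} =>
      G (((u.1 : rationalUnipotent F E c 3) : adelicUnipotent F E c 3) : (quasiSplit F E c 3).Adelic))
    {ξ : E} (hξ : ξ ≠ 0) :
    Summable fun w : rationalTraceZero F E c =>
      G ((heisChart hc (algebraMap E (AdeleRing (𝓞 E) E) ξ, (w : traceZeroAdele F E c)) :
        adelicUnipotent F E c 3) : (quasiSplit F E c 3).Adelic) :=
  (summable_heis_of_summable_ne_one hc G hsum).prod_factor ⟨ξ, hξ⟩

/-- The sum over `ξ ∈ E^×` of the fibre sums is summable. [cite: Rogawski1990, §7.3 Prop. 7.3.2 (pp. 96–97)] -/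
theorem summable_tsum_heis_fibre_of_summable_ne_one (hc : c * c = 1) (G : (quasiSplit F E c 3).Adelic → M)
    (hsum : Summable fun u : {u : rationalUnipotent F E c 3 // u ≠ 1} =>
      G (((u.1 : rationalUnipotent F E c 3) : adelicUnipotent F E c 3) : (quasiSplit F E c 3).Adelic)) :
    Summable fun ξ : {ξ : E // ξ ≠ 0} => ∑' w : rationalTraceZero F E c,
      G ((heisChart hc (algebraMap E (AdeleRing (𝓞 E) E) (ξ.1 : E), (w : traceZeroAdele F E c)) :
        adelicUnipotent F E c 3) : (quasiSplit F E c 3).Adelic) :=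
  (summable_heis_of_summable_ne_one hc G hsum).prod

end Split

/-- **THE SPLIT IN `[0, ∞]`** (no summability hypothesis): for every `G : G(𝔸_F) → [0, ∞]`,
`Σ'_{u ∈ N(F)∖1} G(u) = Σ'_{w ∈ E⁻∖0} G(u(0, w)) + Σ'_{ξ ∈ E^×} Σ'_{w ∈ E⁻} G(u(ξ, w))` — the currency of the absolute-integrability
estimates (the `hint` binder of ★ B1). [cite: Rogawski1990, §7.3 Prop. 7.3.2 (pp. 96–97)] -/
theorem tsum_rationalUnipotent_ne_one_eq_add_ennreal (hc : c * c = 1) (G : (quasiSplit F E c 3).Adelic → ℝ≥0∞) :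
    ∑' u : {u : rationalUnipotent F E c 3 // u ≠ 1},
        G (((u.1 : rationalUnipotent F E c 3) : adelicUnipotent F E c 3) : (quasiSplit F E c 3).Adelic) =
      (∑' w : {w : rationalTraceZero F E c // w ≠ 0},
          G ((heisChart hc ((0 : AdeleRing (𝓞 E) E), ((w.1 : rationalTraceZero F E c) : traceZeroAdele F E c)) :
            adelicUnipotent F E c 3) : (quasiSplit F E c 3).Adelic)) +
        ∑' ξ : {ξ : E // ξ ≠ 0}, ∑' w : rationalTraceZero F E c,
          G ((heisChart hc (algebraMap E (AdeleRing (𝓞 E) E) (ξ.1 : E), (w : traceZeroAdele F E c)) :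
            adelicUnipotent F E c 3) : (quasiSplit F E c 3).Adelic) := by
  obtain ⟨Φ, hΦl, hΦr⟩ := exists_equiv_sum_rationalUnipotent_ne_one (F := F) (E := E) (c := c) hc
  set g : {u : rationalUnipotent F E c 3 // u ≠ 1} → ℝ≥0∞ := fun u =>
    G (((u.1 : rationalUnipotent F E c 3) : adelicUnipotent F E c 3) : (quasiSplit F E c 3).Adelic) with hg
  calc ∑' u, g u = ∑' i, (g ∘ Φ) i := (Equiv.tsum_eq Φ g).symm
    _ = (∑' w, (g ∘ Φ) (Sum.inl w)) + ∑' p, (g ∘ Φ) (Sum.inr p) :=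
        Summable.tsum_sum ENNReal.summable ENNReal.summable
    _ = _ := by
      congr 1
      · refine tsum_congr fun w => ?_
        simp only [Function.comp_apply, hg, hΦl]
      · rw [ENNReal.tsum_prod']
        refine tsum_congr fun ξ => tsum_congr fun w => ?_
        simp only [Function.comp_apply, hg, hΦr]

end UnitaryGroup

end Literature.NumberTheory.Automorphic

end
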